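import Mathlib
import HarnessLib
import Summits.AtomisticToContinuum.FouriersLaw.Theses.JunctionLocality
import Summits.AtomisticToContinuum.FouriersLaw.Theses.StaticAbelianSqueeze
import Summits.AtomisticToContinuum.FouriersLaw.Theorems.JunctionLocalityConductanceLowerBoundAbelFloorConverses

/-!
# Crux `ConductanceLowerBound` (item stmt-AtomisticToContinuum-11749), line `abel-floor-exchange`, skeleton v3:
# the WEAKER bulk stub (A⁻⁻) "Abel floor frequently in the frequency" — composition, converses, and its bulk meaning

Support file (`--supports stmt-AtomisticToContinuum-11749`; closes nothing; lead c7).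

Skeleton v2 of the line cut the crux as (A⁻) ∧ (R⁻) with (A⁻) an `N`-uniform Abel floor `F_N(ν) ≥ aN` at EVERY small Abel frequency
`ν ∈ (0, ν₀)` (`F_N(ν) = ∫₀^∞ e^{−νt} c_N`, `c_N` the equilibrium total-current autocorrelation of the open `N`-chain) and (R⁻) the one-sided
slow regularity `I_N(ν) = ∫₀^∞(1 − e^{−νt})c_N ≥ −εN` (lower half of the sibling item (R), stmt-13416).  The composition uses (A⁻) at ONE frequency
below the threshold of (R⁻) only, so the bulk stub can be weakened to

  (A⁻⁻)  `∃ a > 0 ∀ ν₁ > 0 ∃ ν ∈ (0, ν₁)`, eventually in `N`, `a·N ≤ F_N(ν)`  — an Abel floor FREQUENTLY in `ν ↓ 0`.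

Contents (everything sorry-free; the Kubo identity (K), the Abelian split, the matching S3 and the regular witness are landed):

* `conductanceLowerBound_of_abelFloorFrequently_and_signedSlowRegularity` — **(A⁻⁻) → (R⁻) → crux** (the v3 composition):
  `ν₂ = ν₀(a/2)` from (R⁻), one `ν ∈ (0,ν₂)` from (A⁻⁻), `(N−1)T²D_N = F_N(ν) + I_N(ν) ≥ aN − (a/2)N`, so `D_N ≥ a/(2T²)` eventually.
* `abelFloorFrequently_openChain_of_abelFloor_openChain` — (A⁻) ⇒ (A⁻⁻) (so every landed supplier of (A⁻) — p156938, p157637, p160912,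
  p160999 — supplies (A⁻⁻)).
* `abelFloorFrequently_openChain_of_conductanceLowerBound_of_uniformAbelianRegularity` — **(R) → crux → (A⁻⁻)** (necessity modulo the
  sibling, through p161062's (R) → crux → (A⁻)).
* `bulkWitnessFrequently_of_abelFloorFrequently_openChain`, `abelFloorFrequently_openChain_of_bulkWitnessFrequently`,
  `abelFloorFrequently_openChain_iff_bulkWitnessFrequently` — **(A⁻⁻) ↔ W⁻**, where W⁻ is the SHIFT-INVARIANT BULK statement "NOT AN ABEL
  INSULATOR": a shift-invariant DLR state `μ_T`, a `μ_T`-preserving infinite-volume dynamics with absolutely convergent summed current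
  correlations `C_T`, and `a > 0` such that below every `ν₁ > 0` some `ν ∈ (0, ν₁)` has `a ≤ Â(ν) = ∫₀^∞ e^{−νt} C_T(t) dt` — i.e.
  `limsup_{ν↓0} Â(ν) > 0` (v2's W was `liminf_{ν↓0} Â(ν) > 0`).  `→` at the unconditional regular witness `NonBallistic.stub_infiniteVolumeWitness`
  by S3 (`F_N(ν)/N → Â(ν)`); `←` by regularising the given witness (one-site tightness ⇒ superstability, restriction to `bmGood` orbits) and S3.
* `conductanceLowerBound_iff_bulkWitnessFrequently_of_uniformAbelianRegularity` — **under (R): crux ↔ W⁻**.  With p161062 (under (R):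
  crux ↔ W) the liminf and limsup forms of the bulk floor COINCIDE modulo stmt-13416, and the shared child stmt-11749 is, on every route carrying
  the sibling, exactly "the equilibrium bulk of the pinned anharmonic chain is not an Abel insulator".

This is the statement the line hands back for promotion (weakest form; no rate, no limit, one-sided, one frequency at a time).
References: Kundu–Dhar–Narayan 2009 (open-system Green–Kubo); Bonetto–Lebowitz–Rey-Bellet 2000 §7; Buttà–Marchioro 2016.
No definitions, no named facts, no sorry.
-/

noncomputable section

open MeasureTheory Filter Set Topology
open Literature.MathematicalPhysics.KineticTheory.HeatConduction
open Summit.AtomisticToContinuum.FouriersLaw.Theorems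
open Summit.AtomisticToContinuum.FouriersLaw.Theorems.AbelThermodynamicLimit.SeriesLawAtEveryLaplaceFrequency

namespace Summit.AtomisticToContinuum.FouriersLaw.Cruxes.ConductanceLowerBound.AbelFloorExchange

/-! ## §1 The v3 composition -/

/-- **(A⁻⁻) → (R⁻) → `ConductanceLowerBound`** (stated at the `StaticAbelianSqueeze` copy; the JunctionLocality / CageBudgetFekete / … copies
are definitionally equal): `ν₂ = ν₀(a/2)` from (R⁻), ONE `ν ∈ (0, ν₂)` from (A⁻⁻); the landed Kubo identity (K) and the Abelian split at `ν` give
`(N−1)T²D_N ≥ aN − (a/2)N ≥ (a/2)(N−1)`, so `D_N ≥ a/(2T²)` for `N ≥ max(N₁, N₂, 2)`. [cite: KunduDharNarayan2009, p. 3] -/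
theorem conductanceLowerBound_of_abelFloorFrequently_and_signedSlowRegularity :
    (∀ ω₂ lam β γ : ℝ, 0 < ω₂ → 0 < lam → 0 < β → 0 < γ → ∀ T : ℝ, 0 < T →
      ∃ a : ℝ, 0 < a ∧ ∀ ν₁ : ℝ, 0 < ν₁ → ∃ ν : ℝ, 0 < ν ∧ ν < ν₁ ∧ ∃ N₀ : ℕ, ∀ N : ℕ, N₀ ≤ N →
        a * N ≤ ∫ t in Set.Ioi (0:ℝ), Real.exp (-(ν * t)) *
          ∫ z, (∑ i : Fin N, (pinnedChain ω₂ lam β γ).bondCurrent N i z) *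
            (∫ y, (∑ i : Fin N, (pinnedChain ω₂ lam β γ).bondCurrent N i y)
              ∂((pinnedChain ω₂ lam β γ).transitionKernel N T T t.toNNReal z))
            ∂((pinnedChain ω₂ lam β γ).gibbsMeasure N T)) →
    (∀ ω₂ lam β γ : ℝ, 0 < ω₂ → 0 < lam → 0 < β → 0 < γ → ∀ T : ℝ, 0 < T →
      ∀ ε : ℝ, 0 < ε → ∃ ν₀ : ℝ, 0 < ν₀ ∧ ∀ ν : ℝ, 0 < ν → ν < ν₀ → ∃ N₀ : ℕ, ∀ N : ℕ, N₀ ≤ N →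
        -(ε * N) ≤ ∫ t in Set.Ioi (0:ℝ), (1 - Real.exp (-(ν * t))) *
          ∫ z, (∑ i : Fin N, (pinnedChain ω₂ lam β γ).bondCurrent N i z) *
            (∫ y, (∑ i : Fin N, (pinnedChain ω₂ lam β γ).bondCurrent N i y)
              ∂((pinnedChain ω₂ lam β γ).transitionKernel N T T t.toNNReal z))
            ∂((pinnedChain ω₂ lam β γ).gibbsMeasure N T)) →
    Summit.AtomisticToContinuum.FouriersLaw.Theses.StaticAbelianSqueeze.ConductanceLowerBound := by
  intro hA hR ω₂ lam β γ hω hl hβ hγ hU μ hμ T hT Dn hDn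
  obtain ⟨a, ha, hAν⟩ := hA ω₂ lam β γ hω hl hβ hγ T hT
  obtain ⟨ν₂, hν₂, hRν⟩ := hR ω₂ lam β γ hω hl hβ hγ T hT (a / 2) (by positivity)
  obtain ⟨ν, hν, hνlt, N₁, hN₁⟩ := hAν ν₂ hν₂
  obtain ⟨N₂, hN₂⟩ := hRν ν hν hνlt
  refine ⟨a / (2 * T ^ 2), by positivity, max (max N₁ N₂) 2, fun N hN => ?_⟩
  have hN1 : N₁ ≤ N := le_trans (le_trans (le_max_left _ _) (le_max_left _ _)) hN
  have hN2 : N₂ ≤ N := le_trans (le_trans (le_max_right _ _) (le_max_left _ _)) hN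
  have hN3 : 2 ≤ N := le_trans (le_max_right _ _) hN
  obtain ⟨c, hc⟩ : ∃ c : ℕ → ℝ → ℝ, c = fun (N : ℕ) (t : ℝ) =>
      ∫ z, (∑ i : Fin N, (pinnedChain ω₂ lam β γ).bondCurrent N i z) *
        (∫ y, (∑ i : Fin N, (pinnedChain ω₂ lam β γ).bondCurrent N i y)
          ∂((pinnedChain ω₂ lam β γ).transitionKernel N T T t.toNNReal z))
        ∂((pinnedChain ω₂ lam β γ).gibbsMeasure N T) := ⟨_, rfl⟩
  have hK : IntegrableOn (c N) (Ioi 0) ∧ ((N : ℝ) - 1) * T ^ 2 * Dn N = ∫ t in Ioi (0 : ℝ), c N t := by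
    simpa only [hc] using
      StaticAbelianSqueeze.kuboAbelIdentity_holds ω₂ lam β γ hω hl hβ hγ hU μ hμ T hT N (Dn N) (hDn N)
  have hF : a * N ≤ ∫ t in Ioi (0:ℝ), Real.exp (-(ν * t)) * c N t := by
    simpa only [hc] using hN₁ N hN1
  have hI : -(a / 2 * N) ≤ ∫ t in Ioi (0:ℝ), (1 - Real.exp (-(ν * t))) * c N t := by
    simpa only [hc] using hN₂ N hN2
  have hsplit := integral_abelSplit (c N) ν hν hK.1
  have key : a / 2 * N ≤ ((N : ℝ) - 1) * T ^ 2 * Dn N := by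
    rw [hK.2, hsplit]; linarith
  have hT2 : (0:ℝ) < T ^ 2 := by positivity
  have hNge : (2:ℝ) ≤ N := by exact_mod_cast hN3
  have hpos : (0:ℝ) < (N : ℝ) - 1 := by linarith
  by_contra hlt
  rw [not_le] at hlt
  have h5 : T ^ 2 * Dn N < a / 2 := by
    have := mul_lt_mul_of_pos_left hlt hT2
    rwa [show T ^ 2 * (a / (2 * T ^ 2)) = a / 2 by field_simp] at this
  have h6 : ((N : ℝ) - 1) * (T ^ 2 * Dn N) < ((N : ℝ) - 1) * (a / 2) :=
    mul_lt_mul_of_pos_left h5 hpos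
  have h7 : ((N : ℝ) - 1) * (a / 2) ≤ a / 2 * N := by nlinarith
  have : ((N : ℝ) - 1) * T ^ 2 * Dn N < a / 2 * N := by
    calc ((N : ℝ) - 1) * T ^ 2 * Dn N = ((N : ℝ) - 1) * (T ^ 2 * Dn N) := by ring
      _ < ((N : ℝ) - 1) * (a / 2) := h6
      _ ≤ a / 2 * N := h7
  linarith

/-! ## §2 (A⁻) ⇒ (A⁻⁻), and necessity of (A⁻⁻) modulo (R) -/

/-- **(A⁻) ⇒ (A⁻⁻)**: an Abel floor at every `ν ∈ (0, ν₀)` gives one below every threshold `ν₁` (at `ν = min(ν₀,ν₁)/2`). [folklore] -/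
theorem abelFloorFrequently_openChain_of_abelFloor_openChain
    (hA : ∀ ω₂ lam β γ : ℝ, 0 < ω₂ → 0 < lam → 0 < β → 0 < γ → ∀ T : ℝ, 0 < T →
      ∃ a : ℝ, 0 < a ∧ ∃ ν₀ : ℝ, 0 < ν₀ ∧ ∀ ν : ℝ, 0 < ν → ν < ν₀ → ∃ N₀ : ℕ, ∀ N : ℕ, N₀ ≤ N →
        a * N ≤ ∫ t in Set.Ioi (0:ℝ), Real.exp (-(ν * t)) *
          ∫ z, (∑ i : Fin N, (pinnedChain ω₂ lam β γ).bondCurrent N i z) *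
            (∫ y, (∑ i : Fin N, (pinnedChain ω₂ lam β γ).bondCurrent N i y)
              ∂((pinnedChain ω₂ lam β γ).transitionKernel N T T t.toNNReal z))
            ∂((pinnedChain ω₂ lam β γ).gibbsMeasure N T)) :
    ∀ ω₂ lam β γ : ℝ, 0 < ω₂ → 0 < lam → 0 < β → 0 < γ → ∀ T : ℝ, 0 < T →
      ∃ a : ℝ, 0 < a ∧ ∀ ν₁ : ℝ, 0 < ν₁ → ∃ ν : ℝ, 0 < ν ∧ ν < ν₁ ∧ ∃ N₀ : ℕ, ∀ N : ℕ, N₀ ≤ N →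
        a * N ≤ ∫ t in Set.Ioi (0:ℝ), Real.exp (-(ν * t)) *
          ∫ z, (∑ i : Fin N, (pinnedChain ω₂ lam β γ).bondCurrent N i z) *
            (∫ y, (∑ i : Fin N, (pinnedChain ω₂ lam β γ).bondCurrent N i y)
              ∂((pinnedChain ω₂ lam β γ).transitionKernel N T T t.toNNReal z))
            ∂((pinnedChain ω₂ lam β γ).gibbsMeasure N T) := by
  intro ω₂ lam β γ hω hl hβ hγ T hT
  obtain ⟨a, ha, ν₀, hν₀, h⟩ := hA ω₂ lam β γ hω hl hβ hγ T hT
  refine ⟨a, ha, fun ν₁ hν₁ => ?_⟩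
  have hm : 0 < min ν₀ ν₁ := lt_min hν₀ hν₁
  refine ⟨min ν₀ ν₁ / 2, by positivity, ?_, h _ (by positivity) ?_⟩
  · have : min ν₀ ν₁ ≤ ν₁ := min_le_right _ _
    linarith
  · have : min ν₀ ν₁ ≤ ν₀ := min_le_left _ _
    linarith

/-- **(R) → crux → (A⁻⁻)**: modulo the sibling `UniformAbelianRegularity` (stmt-13416) the weakened bulk stub is still NECESSARY for the crux
(through (R) → crux → (A⁻), `abelFloor_openChain_of_conductanceLowerBound_of_uniformAbelianRegularity`). [cite: KunduDharNarayan2009, p. 3] -/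
theorem abelFloorFrequently_openChain_of_conductanceLowerBound_of_uniformAbelianRegularity
    (hR : Summit.AtomisticToContinuum.FouriersLaw.Theses.StaticAbelianSqueeze.UniformAbelianRegularity)
    (hC : Summit.AtomisticToContinuum.FouriersLaw.Theses.JunctionLocality.ConductanceLowerBound) :
    ∀ ω₂ lam β γ : ℝ, 0 < ω₂ → 0 < lam → 0 < β → 0 < γ → ∀ T : ℝ, 0 < T →
      ∃ a : ℝ, 0 < a ∧ ∀ ν₁ : ℝ, 0 < ν₁ → ∃ ν : ℝ, 0 < ν ∧ ν < ν₁ ∧ ∃ N₀ : ℕ, ∀ N : ℕ, N₀ ≤ N →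
        a * N ≤ ∫ t in Set.Ioi (0:ℝ), Real.exp (-(ν * t)) *
          ∫ z, (∑ i : Fin N, (pinnedChain ω₂ lam β γ).bondCurrent N i z) *
            (∫ y, (∑ i : Fin N, (pinnedChain ω₂ lam β γ).bondCurrent N i y)
              ∂((pinnedChain ω₂ lam β γ).transitionKernel N T T t.toNNReal z))
            ∂((pinnedChain ω₂ lam β γ).gibbsMeasure N T) :=
  abelFloorFrequently_openChain_of_abelFloor_openChain
    (abelFloor_openChain_of_conductanceLowerBound_of_uniformAbelianRegularity hR hC)

/-! ## §3 (A⁻⁻) is exactly "the shift-invariant bulk is not an Abel insulator" -/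

/-- **(A⁻⁻) → W⁻.**  At the tree's unconditional regular witness (`NonBallistic.stub_infiniteVolumeWitness`) the bulk Abel integral obeys
`a ≤ ∫₀^∞e^{−νt}C_T` at some `ν` below every threshold: the landed matching S3 gives `F_N(ν)/N → Â(ν)` and (A⁻⁻) gives `F_N(ν)/N ≥ a`
eventually at that `ν`. [cite: BonettoLebowitzReyBellet2000, §7 eq. (37)] -/
theorem bulkWitnessFrequently_of_abelFloorFrequently_openChain
    (hA : ∀ ω₂ lam β γ : ℝ, 0 < ω₂ → 0 < lam → 0 < β → 0 < γ → ∀ T : ℝ, 0 < T →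
      ∃ a : ℝ, 0 < a ∧ ∀ ν₁ : ℝ, 0 < ν₁ → ∃ ν : ℝ, 0 < ν ∧ ν < ν₁ ∧ ∃ N₀ : ℕ, ∀ N : ℕ, N₀ ≤ N →
        a * N ≤ ∫ t in Set.Ioi (0:ℝ), Real.exp (-(ν * t)) *
          ∫ z, (∑ i : Fin N, (pinnedChain ω₂ lam β γ).bondCurrent N i z) *
            (∫ y, (∑ i : Fin N, (pinnedChain ω₂ lam β γ).bondCurrent N i y)
              ∂((pinnedChain ω₂ lam β γ).transitionKernel N T T t.toNNReal z))
            ∂((pinnedChain ω₂ lam β γ).gibbsMeasure N T)) :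
    ∀ ω₂ lam β γ : ℝ, 0 < ω₂ → 0 < lam → 0 < β → 0 < γ → ∀ T : ℝ, 0 < T →
      ∃ (μT : Measure ChainConfig) (D : InfiniteChainDynamics (pinnedChain ω₂ lam β γ)) (a : ℝ),
        (pinnedChain ω₂ lam β γ).IsChainGibbsMeasure T μT ∧ IsShiftInvariant μT ∧
        D.PreservesMeasure μT ∧ (∀ t : ℝ, D.HasAbsConvergentCorrelation μT t) ∧ 0 < a ∧
        ∀ ν₁ : ℝ, 0 < ν₁ → ∃ ν : ℝ, 0 < ν ∧ ν < ν₁ ∧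
          a ≤ ∫ t in Set.Ioi (0:ℝ), Real.exp (-(ν * t)) * D.currentCorrelation μT t := by
  intro ω₂ lam β γ hω hl hβ hγ T hT
  obtain ⟨μT, D, hG, hS, -, hcar, hP, -, hAC⟩ :=
    NonBallistic.stub_infiniteVolumeWitness ω₂ lam β γ hω hl hβ hγ T hT
  haveI : IsProbabilityMeasure μT := hG.1
  have htight := Literature.MathematicalPhysics.KineticTheory.HeatConduction.oneSiteTight_of_isShiftInvariant
    (μ := μT) hS
  obtain ⟨_, hss⟩ :=
    OscillatorChain.isShiftInvariant_and_hasSuperstabilityEstimate_of_tight_pinnedChain γ hω hl.le hβ.le hT hG htight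
  have hS3 := fixedFrequencyMatching_of_registeredLeaves stub_uniformAnchoredCorrelationTails
    stub_uniformFixedTimeOffsetMatching ω₂ lam β γ hω hl hβ hγ T hT
    (stub_regularDLRUnique ω₂ lam β γ hω hl hβ hγ T hT) μT D hG hS hss hcar hP hAC
  obtain ⟨a, ha, hAν⟩ := hA ω₂ lam β γ hω hl hβ hγ T hT
  refine ⟨μT, D, a, hG, hS, hP, hAC, ha, fun ν₁ hν₁ => ?_⟩
  obtain ⟨ν, hν, hνlt, N₀, hN₀⟩ := hAν ν₁ hν₁
  refine ⟨ν, hν, hνlt, ge_of_tendsto (hS3 ν hν) ?_⟩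
  filter_upwards [eventually_ge_atTop (max N₀ 1)] with N hN
  have hN0 : N₀ ≤ N := le_trans (le_max_left _ _) hN
  have hN1 : 1 ≤ N := le_trans (le_max_right _ _) hN
  have hNpos : (0:ℝ) < N := by exact_mod_cast hN1
  rw [le_div_iff₀ hNpos]
  exact hN₀ N hN0

/-- **W⁻ → (A⁻⁻)**: a shift-invariant bulk witness whose Abel integral is `≥ a` at some frequency below every threshold gives the open chains
the floor `(a/2)·N ≤ F_N(ν)` eventually in `N` at such frequencies (regularisation of the pair — one-site tightness ⇒ superstability, restriction
of the dynamics to `bmGood` orbits with the same flow and correlations — then the landed matching S3). [cite: BonettoLebowitzReyBellet2000, §7 eq. (37)] -/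
theorem abelFloorFrequently_openChain_of_bulkWitnessFrequently
    (hW : ∀ ω₂ lam β γ : ℝ, 0 < ω₂ → 0 < lam → 0 < β → 0 < γ → ∀ T : ℝ, 0 < T →
      ∃ (μT : Measure ChainConfig) (D : InfiniteChainDynamics (pinnedChain ω₂ lam β γ)) (a : ℝ),
        (pinnedChain ω₂ lam β γ).IsChainGibbsMeasure T μT ∧ IsShiftInvariant μT ∧
        D.PreservesMeasure μT ∧ (∀ t : ℝ, D.HasAbsConvergentCorrelation μT t) ∧ 0 < a ∧
        ∀ ν₁ : ℝ, 0 < ν₁ → ∃ ν : ℝ, 0 < ν ∧ ν < ν₁ ∧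
          a ≤ ∫ t in Set.Ioi (0:ℝ), Real.exp (-(ν * t)) * D.currentCorrelation μT t) :
    ∀ ω₂ lam β γ : ℝ, 0 < ω₂ → 0 < lam → 0 < β → 0 < γ → ∀ T : ℝ, 0 < T →
      ∃ a : ℝ, 0 < a ∧ ∀ ν₁ : ℝ, 0 < ν₁ → ∃ ν : ℝ, 0 < ν ∧ ν < ν₁ ∧ ∃ N₀ : ℕ, ∀ N : ℕ, N₀ ≤ N →
        a * N ≤ ∫ t in Set.Ioi (0:ℝ), Real.exp (-(ν * t)) *
          ∫ z, (∑ i : Fin N, (pinnedChain ω₂ lam β γ).bondCurrent N i z) *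
            (∫ y, (∑ i : Fin N, (pinnedChain ω₂ lam β γ).bondCurrent N i y)
              ∂((pinnedChain ω₂ lam β γ).transitionKernel N T T t.toNNReal z))
            ∂((pinnedChain ω₂ lam β γ).gibbsMeasure N T) := by
  intro ω₂ lam β γ hω hl hβ hγ T hT
  obtain ⟨μT, D', a, hG, hS, hP', hAC', ha, hfloor⟩ := hW ω₂ lam β γ hω hl hβ hγ T hT
  haveI : IsProbabilityMeasure μT := hG.1
  have htight := Literature.MathematicalPhysics.KineticTheory.HeatConduction.oneSiteTight_of_isShiftInvariant
    (μ := μT) hS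
  obtain ⟨_, hss⟩ :=
    OscillatorChain.isShiftInvariant_and_hasSuperstabilityEstimate_of_tight_pinnedChain γ hω hl.le hβ.le hT hG htight
  -- regularise the dynamics: restrict to the orbits staying in `bmGood` (same flow)
  have horb : ∀ᵐ σ ∂μT, ∀ t : ℝ, D'.flow t σ ∈ (pinnedChain ω₂ lam β γ).bmGood :=
    OscillatorChain.ae_forall_flow_mem_bmGood_pinnedChain γ hω.le hl hβ hss D' hP'
  obtain ⟨D, hcar, hflow⟩ :=
    GreenKuboContinuation.TemperatureBlindVitaliHurwitz.exists_restrictOrbits D' (pinnedChain ω₂ lam β γ).bmGood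
  have hcarsub : D.carrier ⊆ (pinnedChain ω₂ lam β γ).bmGood := by
    intro σ hσ
    rw [hcar] at hσ
    have h0 := hσ.2 0
    rwa [D'.flow_zero σ hσ.1] at h0
  have hP : D.PreservesMeasure μT := by
    refine GreenKuboContinuation.TemperatureBlindVitaliHurwitz.preservesMeasure_of_flow_eq hflow ?_ hP'
    rw [hcar]
    filter_upwards [hP'.1, horb] with σ h1 h2 using ⟨h1, h2⟩
  have hAC : ∀ t : ℝ, D.HasAbsConvergentCorrelation μT t := fun t => by
    rw [GreenKuboContinuation.TemperatureBlindVitaliHurwitz.hasAbsConvergentCorrelation_iff_of_flow_eq hflow]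
    exact hAC' t
  have hcorr : D.currentCorrelation μT = D'.currentCorrelation μT :=
    GreenKuboContinuation.TemperatureBlindVitaliHurwitz.currentCorrelation_eq_of_flow_eq hflow μT
  have hS3 := fixedFrequencyMatching_of_registeredLeaves stub_uniformAnchoredCorrelationTails
    stub_uniformFixedTimeOffsetMatching ω₂ lam β γ hω hl hβ hγ T hT
    (stub_regularDLRUnique ω₂ lam β γ hω hl hβ hγ T hT) μT D hG hS hss hcarsub hP hAC
  refine ⟨a / 2, by positivity, fun ν₁ hν₁ => ?_⟩
  obtain ⟨ν, hν, hνlt, hA⟩ := hfloor ν₁ hν₁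
  refine ⟨ν, hν, hνlt, ?_⟩
  have hA' : a ≤ ∫ t in Ioi (0:ℝ), Real.exp (-(ν * t)) * D.currentCorrelation μT t := by
    rw [hcorr]; exact hA
  have hlt2 : a / 2 < ∫ t in Ioi (0:ℝ), Real.exp (-(ν * t)) * D.currentCorrelation μT t := by linarith
  have hev := (hS3 ν hν).eventually (Ioi_mem_nhds hlt2)
  obtain ⟨N₀, hN₀⟩ := Filter.eventually_atTop.mp (hev.and (eventually_ge_atTop 1))
  refine ⟨N₀, fun N hN => ?_⟩
  obtain ⟨h1, h2⟩ := hN₀ N hN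
  have hNpos : (0:ℝ) < N := by exact_mod_cast h2
  exact ((lt_div_iff₀ hNpos).mp h1).le

/-- **(A⁻⁻) ↔ W⁻: the v3 stub `stub_openChainAbelFloorFrequently` IS "the shift-invariant Gibbs bulk is not an Abel insulator"**
(`limsup_{ν↓0} Â(ν) > 0` at a — equivalently, by S3, every — regular witness). [cite: BonettoLebowitzReyBellet2000, §7 eq. (37)] -/
theorem abelFloorFrequently_openChain_iff_bulkWitnessFrequently :
    (∀ ω₂ lam β γ : ℝ, 0 < ω₂ → 0 < lam → 0 < β → 0 < γ → ∀ T : ℝ, 0 < T →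
      ∃ a : ℝ, 0 < a ∧ ∀ ν₁ : ℝ, 0 < ν₁ → ∃ ν : ℝ, 0 < ν ∧ ν < ν₁ ∧ ∃ N₀ : ℕ, ∀ N : ℕ, N₀ ≤ N →
        a * N ≤ ∫ t in Set.Ioi (0:ℝ), Real.exp (-(ν * t)) *
          ∫ z, (∑ i : Fin N, (pinnedChain ω₂ lam β γ).bondCurrent N i z) *
            (∫ y, (∑ i : Fin N, (pinnedChain ω₂ lam β γ).bondCurrent N i y)
              ∂((pinnedChain ω₂ lam β γ).transitionKernel N T T t.toNNReal z))
            ∂((pinnedChain ω₂ lam β γ).gibbsMeasure N T)) ↔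
    (∀ ω₂ lam β γ : ℝ, 0 < ω₂ → 0 < lam → 0 < β → 0 < γ → ∀ T : ℝ, 0 < T →
      ∃ (μT : Measure ChainConfig) (D : InfiniteChainDynamics (pinnedChain ω₂ lam β γ)) (a : ℝ),
        (pinnedChain ω₂ lam β γ).IsChainGibbsMeasure T μT ∧ IsShiftInvariant μT ∧
        D.PreservesMeasure μT ∧ (∀ t : ℝ, D.HasAbsConvergentCorrelation μT t) ∧ 0 < a ∧
        ∀ ν₁ : ℝ, 0 < ν₁ → ∃ ν : ℝ, 0 < ν ∧ ν < ν₁ ∧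
          a ≤ ∫ t in Set.Ioi (0:ℝ), Real.exp (-(ν * t)) * D.currentCorrelation μT t) :=
  ⟨bulkWitnessFrequently_of_abelFloorFrequently_openChain, abelFloorFrequently_openChain_of_bulkWitnessFrequently⟩

/-! ## §4 Under (R) the crux is exactly W⁻ -/

/-- **Under (R) = `UniformAbelianRegularity` (stmt-13416): `ConductanceLowerBound ↔ W⁻`.**  `→`: (R) → crux → (A⁻⁻) → W⁻; `←`: W⁻ → (A⁻⁻),
(R) → (R⁻), and the v3 composition.  Together with p161062 (under (R): crux ↔ W) the liminf- and limsup-forms of the bulk Abel floor agree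
modulo the sibling, and stmt-11749 is exactly "the bulk is not an Abel insulator" on every route that files stmt-13416. [cite: KunduDharNarayan2009, p. 3] -/
theorem conductanceLowerBound_iff_bulkWitnessFrequently_of_uniformAbelianRegularity
    (hR : Summit.AtomisticToContinuum.FouriersLaw.Theses.StaticAbelianSqueeze.UniformAbelianRegularity) :
    Summit.AtomisticToContinuum.FouriersLaw.Theses.JunctionLocality.ConductanceLowerBound ↔
    (∀ ω₂ lam β γ : ℝ, 0 < ω₂ → 0 < lam → 0 < β → 0 < γ → ∀ T : ℝ, 0 < T →
      ∃ (μT : Measure ChainConfig) (D : InfiniteChainDynamics (pinnedChain ω₂ lam β γ)) (a : ℝ),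
        (pinnedChain ω₂ lam β γ).IsChainGibbsMeasure T μT ∧ IsShiftInvariant μT ∧
        D.PreservesMeasure μT ∧ (∀ t : ℝ, D.HasAbsConvergentCorrelation μT t) ∧ 0 < a ∧
        ∀ ν₁ : ℝ, 0 < ν₁ → ∃ ν : ℝ, 0 < ν ∧ ν < ν₁ ∧
          a ≤ ∫ t in Set.Ioi (0:ℝ), Real.exp (-(ν * t)) * D.currentCorrelation μT t) :=
  ⟨fun hC => bulkWitnessFrequently_of_abelFloorFrequently_openChain
      (abelFloorFrequently_openChain_of_conductanceLowerBound_of_uniformAbelianRegularity hR hC),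
    fun hW => conductanceLowerBound_of_abelFloorFrequently_and_signedSlowRegularity
      (abelFloorFrequently_openChain_of_bulkWitnessFrequently hW) (slowRegularity_signed_of_uniformAbelianRegularity hR)⟩

end Summit.AtomisticToContinuum.FouriersLaw.Cruxes.ConductanceLowerBound.AbelFloorExchange

end
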